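import Summits.KontsevichZagierPeriods.KontsevichZagierPeriods.Theorems.LinRedNormalFormArrangementNormalFormSeparateThreeHIRim
import Summits.KontsevichZagierPeriods.KontsevichZagierPeriods.Theorems.LinRedNormalFormArrangementNormalFormSeparateThreeHIColumnN

/-!
# The column lemma of the fibre-free termwise split in dimension three

(Line `janus-bands`, crux `ArrangementNormalForm`, stub `stub_separateThreeZero`, part `HIColumn` of
the termwise numerator split `separateThree_hI` under the rim condition.)

`column` (registered as `separateThree_column`): for the open polyhedral cell `Ω` (bounded, above
the pole plane if `n ≠ 0`), the integrand `Fform` absolutely integrable on `Ω`, no letter of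
non-zero exponent identically zero, and the RIM CONDITION, every base point `v₀` has a radius
`δ > 0` and a finite constant `C` with `FI i v ≤ C · (FF v + ‖v − v₀‖⁻¹ + 1)` for all base points
`v ≠ v₀`, `‖v − v₀‖ < δ` (`FI i`, `FF` the fibre integrals of the `i`-th absolute Taylor piece and
of the absolute integrand). Cases on the closed vertical fibre `Z` of `Ω` over `v₀`: `Z = ∅` (empty
fibres nearby, `colBound_of_empty`); `Z = {w⋆}` with `w⋆ ≠ 0` or `n = 0` (bounded pieces nearby —
the rim condition excludes letters through `v₀`, `colBound_of_bounded`); `Z = {0}` with `n ≠ 0`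
(the rim vertex, part `HIRim`); `Z` with two points (part `HIColumnN`).
-/

noncomputable section

open Set MeasureTheory Filter Topology
open scoped ENNReal

namespace Summit.KontsevichZagierPeriods.ArrangementNormalForm.JanusBands

namespace SepThree

section Column

variable {J m : ℕ} (g : Fin J → Con) (κ : Fin m → Fin 2 → ℝ) (μ : Fin m → ℝ) (e : Fin m → ℕ)
  (N : ℕ) (q : ℕ → MvPolynomial (Fin 2) ℝ) (n : ℕ) (i : ℕ) (v₀ : Fin 2 → ℝ)

/-- **Empty closed fibre.** -/
theorem colBound_of_empty (hbd : Bornology.IsBounded (Om3 g))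
    (hZe : ∀ w : ℝ, ((v₀, w) : (Fin 2 → ℝ) × ℝ) ∉ closure (Om3 g)) :
    ∃ δ > 0, ∃ C : ℝ≥0∞, C ≠ ∞ ∧ ∀ v : Fin 2 → ℝ, v ≠ v₀ → ‖v - v₀‖ < δ →
      FI κ μ e q n (Om3 g) i v ≤ C * (FF κ μ e N q n (Om3 g) v + ENNReal.ofReal ‖v - v₀‖⁻¹ + 1) := by
  obtain ⟨δ, hδ, hgap⟩ := exists_gap hbd.isCompact_closure isClosed_univ v₀ (fun w _ => hZe w)
  refine colBound_of_const g κ μ e N q n i v₀ hδ (K := 0) fun v hv => ?_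
  have hemp : fib (Om3 g) v = ∅ := eq_empty_of_forall_notMem fun w hw => by
    have := hgap (v, w) (subset_closure hw) (mem_univ _)
    simp only at this
    linarith
  rw [FI_eq_zero_of_empty κ μ e q n i hemp]
  exact zero_le

/-- **Degenerate closed fibre off the pole plane (or no pole): bounded pieces.** -/
theorem colBound_of_bounded (hbd : Bornology.IsBounded (Om3 g)) {R : ℝ} (hR : ∀ p ∈ Om3 g, |p.2| < R)
    (hpos : n ≠ 0 → ∀ p ∈ Om3 g, 0 < p.2) {ws : ℝ}
    (hws : ((v₀, ws) : (Fin 2 → ℝ) × ℝ) ∈ closure (Om3 g))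
    (hZ : ∀ w : ℝ, ((v₀, w) : (Fin 2 → ℝ) × ℝ) ∈ closure (Om3 g) → w = ws) (hD : ws ≠ 0 ∨ n = 0)
    (hRim : ∀ p ∈ closure (Om3 g), (∃ j, e j ≠ 0 ∧ lval κ μ j p.1 = 0) →
      (n ≠ 0 ∧ p.2 = 0) ∨ ∃ p' ∈ closure (Om3 g), p' ≠ p ∧ p'.1 = p.1) :
    ∃ δ > 0, ∃ C : ℝ≥0∞, C ≠ ∞ ∧ ∀ v : Fin 2 → ℝ, v ≠ v₀ → ‖v - v₀‖ < δ →
      FI κ μ e q n (Om3 g) i v ≤ C * (FF κ μ e N q n (Om3 g) v + ENNReal.ofReal ‖v - v₀‖⁻¹ + 1) := by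
  classical
  -- no letter of non-zero exponent passes through `v₀` (rim condition)
  have hL0 : ∀ j, e j ≠ 0 → lval κ μ j v₀ ≠ 0 := by
    intro j hej hjv
    rcases hRim (v₀, ws) hws ⟨j, hej, hjv⟩ with ⟨hn, hw0⟩ | ⟨p', hp', hne, hfst⟩
    · simp only at hw0
      rcases hD with h | h
      · exact h hw0
      · exact hn h
    · apply hne
      simp only at hfst
      have hp'eq : p' = (v₀, p'.2) := Prod.ext hfst rfl
      have := hZ p'.2 (hp'eq ▸ hp')
      rw [hp'eq, this]
  have hW0 : Wt κ μ e v₀ ≠ 0 := by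
    unfold Wt
    refine Finset.prod_ne_zero_iff.2 fun j _ => ?_
    by_cases hej : e j = 0
    · simp [hej]
    · exact pow_ne_zero _ (hL0 j hej)
  -- continuity of the letter block and of the coefficient
  have hWa : 0 < |Wt κ μ e v₀| := abs_pos.2 hW0
  obtain ⟨δ₁, hδ₁, hW⟩ := Metric.continuousAt_iff.1 (continuous_Wt κ μ e).continuousAt (|Wt κ μ e v₀| / 2)
    (half_pos hWa)
  obtain ⟨δ₂, hδ₂, hQ⟩ := Metric.continuousAt_iff.1 (continuous_Qv q i).continuousAt 1 one_pos
  -- heights near the column when `n ≠ 0`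
  obtain ⟨δ₃, hδ₃, hheight⟩ : ∃ δ₃ > 0, ∀ p ∈ Om3 g, ‖p.1 - v₀‖ < δ₃ → n ≠ 0 →
      ws / 2 < p.2 ∧ p.2 < 3 * ws / 2 := by
    by_cases hn : n = 0
    · exact ⟨1, one_pos, fun p _ _ hn' => absurd hn hn'⟩
    · have hws0 : 0 < ws := by
        have hge : 0 ≤ ws := closure_minimal (fun q (hq : q ∈ Om3 g) => (hpos hn q hq).le)
          (isClosed_le continuous_const continuous_snd) hws
        exact hge.lt_of_ne (fun h => (hD.resolve_right hn) h.symm)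
      obtain ⟨δ₃, hδ₃, hg⟩ := exists_gap hbd.isCompact_closure (T := {w : ℝ | ws / 2 ≤ |w - ws|})
        (isClosed_le continuous_const (continuous_id.sub continuous_const).abs) v₀ (fun w hw hmem => by
          have := hZ w hmem
          subst this
          simp only [mem_setOf_eq, sub_self, abs_zero] at hw
          linarith)
      refine ⟨δ₃, hδ₃, fun p hp hpv _ => ?_⟩
      have : ¬(ws / 2 ≤ |p.2 - ws|) := fun h => by
        have := hg p (subset_closure hp) h
        linarith
      push Not at this
      rw [abs_lt] at this
      constructor <;> linarith
  -- the bound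
  set Bw : ℝ := if n = 0 then |R| ^ i else (3 * ws / 2) ^ i / (ws / 2) ^ n with hBw
  set K : ℝ := (|Qv q i v₀| + 1) / (|Wt κ μ e v₀| / 2) * Bw with hK
  refine colBound_of_const g κ μ e N q n i v₀ (lt_min hδ₁ (lt_min hδ₂ hδ₃)) (K := 2 * R * K) fun v hv => ?_
  refine FI_le_of_bounded κ μ e q n hR i v fun w hw => ?_
  have hv1 : ‖v - v₀‖ < δ₁ := hv.trans_le (min_le_left _ _)
  have hv2 : ‖v - v₀‖ < δ₂ := hv.trans_le ((min_le_right _ _).trans (min_le_left _ _))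
  have hv3 : ‖v - v₀‖ < δ₃ := hv.trans_le ((min_le_right _ _).trans (min_le_right _ _))
  have hWv : |Wt κ μ e v₀| / 2 ≤ |Wt κ μ e v| := by
    have := hW (show dist v v₀ < δ₁ by rw [dist_eq_norm]; exact hv1)
    rw [Real.dist_eq] at this
    have := abs_sub_abs_le_abs_sub (Wt κ μ e v₀) (Wt κ μ e v)
    rw [abs_sub_comm] at this
    linarith
  have hQv : |Qv q i v| ≤ |Qv q i v₀| + 1 := by
    have := hQ (show dist v v₀ < δ₂ by rw [dist_eq_norm]; exact hv2)
    rw [Real.dist_eq] at this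
    have := abs_sub_abs_le_abs_sub (Qv q i v) (Qv q i v₀)
    linarith
  have hwB : |w ^ i / w ^ n| ≤ Bw := by
    rw [hBw]
    split_ifs with hn
    · rw [hn, pow_zero, div_one, abs_pow]
      exact pow_le_pow_left₀ (abs_nonneg _) ((hR (v, w) hw).le.trans (le_abs_self R)) _
    · obtain ⟨hw1, hw2⟩ := hheight (v, w) hw hv3 hn
      simp only at hw1 hw2
      have hws0 : 0 < ws := by linarith [hpos hn (v, w) hw]
      have hw0 : 0 < w := hpos hn (v, w) hw
      rw [abs_div, abs_pow, abs_pow, abs_of_pos hw0]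
      exact div_le_div₀ (by positivity) (pow_le_pow_left₀ hw0.le hw2.le _) (by positivity)
        (pow_le_pow_left₀ (by positivity) hw1.le _)
  have hBw0 : 0 ≤ Bw := (abs_nonneg _).trans hwB
  rw [show tpiece κ μ e q n i (v, w) = Qv q i v / Wt κ μ e v * (w ^ i / w ^ n) from rfl, abs_mul,
    abs_div (Qv q i v)]
  calc |Qv q i v| / |Wt κ μ e v| * |w ^ i / w ^ n|
      ≤ (|Qv q i v₀| + 1) / (|Wt κ μ e v₀| / 2) * Bw := by
        refine mul_le_mul (div_le_div₀ (by positivity) hQv (half_pos hWa) hWv) hwB (abs_nonneg _)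
          (by positivity)
    _ = K := by rw [hK]

/-- **The column lemma.** See the module docstring. -/
theorem column (hbd : Bornology.IsBounded (Om3 g)) {R : ℝ} (hR0 : 0 < R) (hR : ∀ p ∈ Om3 g, |p.2| < R)
    (hpos : n ≠ 0 → ∀ p ∈ Om3 g, 0 < p.2) (hint : IntegrableOn (Fform κ μ e N q n) (Om3 g))
    (hnd : ∀ j, e j ≠ 0 → ¬(κ j = 0 ∧ μ j = 0))
    (hRim : ∀ p ∈ closure (Om3 g), (∃ j, e j ≠ 0 ∧ lval κ μ j p.1 = 0) →
      (n ≠ 0 ∧ p.2 = 0) ∨ ∃ p' ∈ closure (Om3 g), p' ≠ p ∧ p'.1 = p.1)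
    (hi : i < N) :
    ∃ δ > 0, ∃ C : ℝ≥0∞, C ≠ ∞ ∧ ∀ v : Fin 2 → ℝ, v ≠ v₀ → ‖v - v₀‖ < δ →
      FI κ μ e q n (Om3 g) i v ≤ C * (FF κ μ e N q n (Om3 g) v + ENNReal.ofReal ‖v - v₀‖⁻¹ + 1) := by
  classical
  by_cases hZe : ∀ w : ℝ, ((v₀, w) : (Fin 2 → ℝ) × ℝ) ∉ closure (Om3 g)
  · exact colBound_of_empty g κ μ e N q n i v₀ hbd hZe
  push Not at hZe
  obtain ⟨ws, hws⟩ := hZe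
  by_cases hZ1 : ∀ w : ℝ, ((v₀, w) : (Fin 2 → ℝ) × ℝ) ∈ closure (Om3 g) → w = ws
  · by_cases hD : ws ≠ 0 ∨ n = 0
    · exact colBound_of_bounded g κ μ e N q n i v₀ hbd hR hpos hws hZ1 hD hRim
    · push Not at hD
      obtain ⟨hws0, hn⟩ := hD
      subst hws0
      obtain ⟨δ, hδ, C, hC, hb⟩ := rim_column g κ μ e N q n v₀ hbd hws hZ1 (hpos hn) hint hnd hRim i hi
      refine ⟨δ, hδ, C, hC, fun v hv hvδ => ?_⟩
      have := hb (v - v₀) (sub_ne_zero.2 hv) hvδ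
      rwa [add_sub_cancel] at this
  · push Not at hZ1
    obtain ⟨w₂, hw₂, hne⟩ := hZ1
    obtain ⟨wa, wb, hwa, hwb, hab⟩ : ∃ wa wb : ℝ, ((v₀, wa) : (Fin 2 → ℝ) × ℝ) ∈ closure (Om3 g) ∧
        ((v₀, wb) : (Fin 2 → ℝ) × ℝ) ∈ closure (Om3 g) ∧ wa < wb := by
      rcases lt_or_gt_of_ne hne with h | h
      · exact ⟨w₂, ws, hw₂, hws, h⟩
      · exact ⟨ws, w₂, hws, hw₂, h⟩
    rcases Nat.eq_zero_or_pos n with hn | hn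
    · exact colBound_of_fixed g κ μ e N q n i v₀ hbd hR0 hR hi hwa hwb hab one_pos
        (fun h => absurd hn h)
    · have hpos' := hpos hn.ne'
      have hup : ∀ p ∈ closure (Om3 g), 0 ≤ p.2 := fun p hp =>
        closure_minimal (fun q (hq : q ∈ Om3 g) => (hpos' q hq).le)
          (isClosed_le continuous_const continuous_snd) hp
      by_cases h0 : ((v₀, (0 : ℝ)) : (Fin 2 → ℝ) × ℝ) ∈ closure (Om3 g)
      · exact colBound_of_touch g κ μ e N q n i v₀ hpos' hR hi h0 hwb (lt_of_le_of_lt (hup _ hwa) hab)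
      · set Z : Set ℝ := {w | ((v₀, w) : (Fin 2 → ℝ) × ℝ) ∈ closure (Om3 g)} with hZdef
        have hZne : Z.Nonempty := ⟨wa, hwa⟩
        have hZbdd : BddBelow Z := ⟨0, fun w hw => hup _ hw⟩
        have hZcl : IsClosed Z := isClosed_closure.preimage (continuous_const.prodMk continuous_id)
        have hmin : sInf Z ∈ Z := hZcl.csInf_mem hZne hZbdd
        have hmin0 : 0 < sInf Z := (hup _ hmin).lt_of_ne (fun h => h0 (by
          have hm : ((v₀, sInf Z) : (Fin 2 → ℝ) × ℝ) ∈ closure (Om3 g) := hmin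
          have h' : sInf Z = 0 := by simpa using h.symm
          rwa [h'] at hm))
        exact colBound_of_fixed g κ μ e N q n i v₀ hbd hR0 hR hi hwa hwb hab (L := sInf Z / 2)
          (half_pos hmin0) (fun _ w hw => by have := csInf_le hZbdd hw; linarith)

end Column

end SepThree

/-- **The column lemma** (registered part of `stub_separateThreeZero`; literal form of
`SepThree.column`): for the bounded open polyhedral cell `Ω` over the base plane, with `|w| < R`
on `Ω`, `Ω` above the pole plane when `n ≠ 0`, the integrand `Fform` absolutely integrable on `Ω`,
no letter of non-zero exponent identically zero and the rim condition, every base point `v₀` has a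
radius `δ > 0` and a finite constant `C` such that the fibre integral of the `i`-th absolute Taylor
piece satisfies `FI i v ≤ C · (FF v + ‖v − v₀‖⁻¹ + 1)` for all `v ≠ v₀` with `‖v − v₀‖ < δ`. -/
theorem separateThree_column {J m : ℕ} (g : Fin J → (Fin 2 → ℝ) × ℝ × ℝ) (κ : Fin m → Fin 2 → ℝ) (μ : Fin m → ℝ) (e : Fin m → ℕ) (N : ℕ) (q : ℕ → MvPolynomial (Fin 2) ℝ) (n : ℕ) (i : ℕ) (v₀ : Fin 2 → ℝ) (hbd : Bornology.IsBounded (SepThree.Om3 g)) {R : ℝ} (hR0 : 0 < R) (hR : ∀ p ∈ SepThree.Om3 g, |p.2| < R) (hpos : n ≠ 0 → ∀ p ∈ SepThree.Om3 g, 0 < p.2) (hint : MeasureTheory.IntegrableOn (SepThree.Fform κ μ e N q n) (SepThree.Om3 g)) (hnd : ∀ j, e j ≠ 0 → ¬(κ j = 0 ∧ μ j = 0)) (hRim : ∀ p ∈ closure (SepThree.Om3 g), (∃ j, e j ≠ 0 ∧ SepThree.lval κ μ j p.1 = 0) → (n ≠ 0 ∧ p.2 = 0) ∨ ∃ p' ∈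 closure (SepThree.Om3 g), p' ≠ p ∧ p'.1 = p.1) (hi : i < N) : ∃ δ > 0, ∃ C : ENNReal, C ≠ ⊤ ∧ ∀ v : Fin 2 → ℝ, v ≠ v₀ → ‖v - v₀‖ < δ → SepThree.FI κ μ e q n (SepThree.Om3 g) i v ≤ C * (SepThree.FF κ μ e N q n (SepThree.Om3 g) v + ENNReal.ofReal ‖v - v₀‖⁻¹ + 1) := by
  exact SepThree.column g κ μ e N q n i v₀ hbd hR0 hR hpos hint hnd hRim hi

end Summit.KontsevichZagierPeriods.ArrangementNormalForm.JanusBands
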